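import Mathlib

/-!
# NearExit (S4) — fibre-prime algebra: Jacobson avoidance and order along the fibre

Node «NearExit» of `decomp-res-lens-2` (g33), see `NearExitTau.lean`.  The fibre of the blow-up of a regular closed
point over that point is the affine space `Spec κ[X₁, …, X_d]` of a chart; a (possibly NON-CLOSED) point `x'` of the
blow-up over the centre corresponds to a prime `𝔮` of `F = κ[X]`, and «the face form `Φ` has order `≥ n` at `x'`»
reads `Φ ∈ 𝔮ⁿ F_𝔮`.  This file turns that into a statement at a CLOSED point avoiding a prescribed finite set of
closed points (the rational matched directions of `VeryNearCutClasses.HasNearGenericFace`):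

* `exists_isMaximal_avoid` [Jacobson avoidance]: in a Jacobson ring, for a prime `𝔮`, an element `s ∉ 𝔮` and a
  finite set `M` of ideals none of which is `≤ 𝔮`, some maximal ideal `𝔪 ⊇ 𝔮` avoids `s` and lies outside `M`
  (`𝔮` is the intersection of the maximal ideals above it; `s · ∏_{𝔪 ∈ M} a_𝔪 ∉ 𝔮` for `a_𝔪 ∈ 𝔪 ∖ 𝔮`).
* `mem_pow_of_mul_mem_pow` : `𝔪` maximal, `s ∉ 𝔪`, `s·Φ ∈ 𝔪ⁿ ⇒ Φ ∈ 𝔪ⁿ` (`s` is a unit modulo `𝔪ⁿ`).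
(the localisation step — clearing denominators `Φ/1 ∈ I·F_𝔮 ⇒ s·Φ ∈ I` for some `s ∉ 𝔮` — is
`NearExitTransfer.exists_mul_mem_of_algebraMap_mem_map`, from Mathlib's `IsLocalization.mem_map_algebraMap_iff`).

Sources: [CossartPiltant2008] proof of Prop. 4.2 (the non-closed near points); Matsumura, *Commutative Ring
Theory*, §5 (Jacobson rings) [Matsumura1987]; [StacksProject, Tag 00G3].
-/

open IsLocalRing

namespace Summit.ResolutionOfSingularities.ResolutionOfSingularities.Theorems.NearExit

section Fibre

variable {F : Type} [CommRing F]

/-- **Jacobson avoidance.** In a Jacobson ring, given a prime `𝔮`, `s ∉ 𝔮`, and a finite set `M` of ideals none of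
which is contained in `𝔮`, there is a maximal ideal `𝔪 ⊇ 𝔮` with `s ∉ 𝔪` and `𝔪 ∉ M`. [cite: Matsumura1987, §5] -/
theorem exists_isMaximal_avoid [IsJacobsonRing F] {𝔮 : Ideal F} (h𝔮 : 𝔮.IsPrime) {s : F} (hs : s ∉ 𝔮)
    (M : Finset (Ideal F)) (hM : ∀ 𝔪 ∈ M, ¬ 𝔪 ≤ 𝔮) :
    ∃ 𝔪 : Ideal F, 𝔪.IsMaximal ∧ 𝔮 ≤ 𝔪 ∧ s ∉ 𝔪 ∧ 𝔪 ∉ M := by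
  classical
  -- an element `a 𝔪 ∈ 𝔪 ∖ 𝔮` for each member of `M`
  have hch : ∀ 𝔪 : Ideal F, ∃ a : F, 𝔪 ∈ M → a ∈ 𝔪 ∧ a ∉ 𝔮 := by
    intro 𝔪
    by_cases h : 𝔪 ∈ M
    · obtain ⟨a, ha, ha'⟩ := Set.not_subset.mp (hM 𝔪 h)
      exact ⟨a, fun _ => ⟨ha, ha'⟩⟩
    · exact ⟨0, fun h' => absurd h' h⟩
  choose a ha using hch
  set e : F := s * ∏ 𝔪 ∈ M, a 𝔪 with he
  have heq : 𝔮.jacobson = 𝔮 := IsJacobsonRing.out ‹_› h𝔮.isRadical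
  have he𝔮 : e ∉ 𝔮 := by
    rw [he]
    intro hmem
    rcases h𝔮.mem_or_mem hmem with h1 | h2
    · exact hs h1
    · obtain ⟨𝔪, h𝔪M, h𝔪a⟩ := Ideal.IsPrime.prod_mem_iff.mp h2
      exact (ha 𝔪 h𝔪M).2 h𝔪a
  by_contra hcon
  push Not at hcon
  apply he𝔮
  rw [← heq, Ideal.jacobson, Ideal.mem_sInf]
  rintro 𝔪 ⟨h𝔮𝔪, h𝔪max⟩
  by_cases hsm : s ∈ 𝔪
  · exact Ideal.mul_mem_right _ _ hsm
  · have h𝔪M : 𝔪 ∈ M := hcon 𝔪 h𝔪max h𝔮𝔪 hsm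
    rw [he, ← Finset.mul_prod_erase M a h𝔪M]
    exact Ideal.mul_mem_left _ _ (Ideal.mul_mem_right _ _ (ha 𝔪 h𝔪M).1)

/-- **A non-member is a unit modulo every power of a maximal ideal**: `𝔪` maximal, `s ∉ 𝔪`, `s·Φ ∈ 𝔪ⁿ ⇒ Φ ∈ 𝔪ⁿ`.
[folklore] -/
theorem mem_pow_of_mul_mem_pow {𝔪 : Ideal F} (h𝔪 : 𝔪.IsMaximal) {s Φ : F} (hs : s ∉ 𝔪) (n : ℕ)
    (h : s * Φ ∈ 𝔪 ^ n) : Φ ∈ 𝔪 ^ n := by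
  -- `yₙ s + iₙ = 1` with `iₙ ∈ 𝔪ⁿ`
  have key : ∀ k : ℕ, ∃ y i : F, i ∈ 𝔪 ^ k ∧ y * s + i = 1 := by
    intro k
    induction k with
    | zero => exact ⟨0, 1, by rw [pow_zero, Ideal.one_eq_top]; exact Submodule.mem_top, by ring⟩
    | succ k ih =>
      obtain ⟨y, i, hi, hyi⟩ := ih
      obtain ⟨y₁, i₁, hi₁, hyi₁⟩ := h𝔪.exists_inv hs
      refine ⟨y * y₁ * s + y * i₁ + i * y₁, i * i₁, ?_, ?_⟩
      · rw [pow_succ]; exact Ideal.mul_mem_mul hi hi₁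
      · have : (y * s + i) * (y₁ * s + i₁) = 1 := by rw [hyi, hyi₁, one_mul]
        rw [← this]; ring
  obtain ⟨y, i, hi, hyi⟩ := key n
  have heq : Φ = y * (s * Φ) + i * Φ := by
    calc Φ = (y * s + i) * Φ := by rw [hyi, one_mul]
      _ = y * (s * Φ) + i * Φ := by ring
  rw [heq]
  exact Ideal.add_mem _ (Ideal.mul_mem_left _ _ h) (Ideal.mul_mem_right _ _ hi)

end Fibre

section EvalMap

variable {R L : Type} [CommRing R] [CommRing L]

/-- `σ(F(v)) = F^σ(σ ∘ v)`. [folklore] -/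
theorem map_eval_eq_eval_map (σ : R →+* L) {ι : Type} (v : ι → R) (F : MvPolynomial ι R) :
    σ (MvPolynomial.eval v F) = MvPolynomial.eval (σ ∘ v) (MvPolynomial.map σ F) := by
  induction F using MvPolynomial.induction_on with
  | C r => simp
  | add p q hp hq => simp [hp, hq]
  | mul_X p k hp => simp [hp]

/-- Substitutions agreeing off one index differ by a multiple of the difference at that index:
`P(a) - P(b) ∈ (a_i - b_i)` if `a_k = b_k` for `k ≠ i`. [folklore] -/
theorem aeval_sub_aeval_mem_span {A : Type} [CommRing A] [Algebra R A] {ι : Type} (P : MvPolynomial ι R)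
    (a b : ι → A) (i : ι) (h : ∀ k, k ≠ i → a k = b k) :
    MvPolynomial.aeval a P - MvPolynomial.aeval b P ∈ Ideal.span {a i - b i} := by
  induction P using MvPolynomial.induction_on with
  | C r => simp
  | add p q hp hq =>
    have : MvPolynomial.aeval a (p + q) - MvPolynomial.aeval b (p + q) =
        (MvPolynomial.aeval a p - MvPolynomial.aeval b p) +
          (MvPolynomial.aeval a q - MvPolynomial.aeval b q) := by
      simp only [map_add]; ring
    rw [this]
    exact Ideal.add_mem _ hp hq
  | mul_X p k hp =>
    have : MvPolynomial.aeval a (p * MvPolynomial.X k) - MvPolynomial.aeval b (p * MvPolynomial.X k) =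
        (MvPolynomial.aeval a p - MvPolynomial.aeval b p) * a k +
          MvPolynomial.aeval b p * (a k - b k) := by
      simp only [map_mul, MvPolynomial.aeval_X]; ring
    rw [this]
    refine Ideal.add_mem _ (Ideal.mul_mem_right _ _ hp) ?_
    by_cases hk : k = i
    · subst hk
      exact Ideal.mul_mem_left _ _ (Ideal.mem_span_singleton_self _)
    · rw [h k hk, sub_self, mul_zero]
      exact Ideal.zero_mem _

end EvalMap


end Summit.ResolutionOfSingularities.ResolutionOfSingularities.Theorems.NearExit
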